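import Mathlib
import Literature.NumberTheory.Irrationality.BrownZudilin2022.GeneralFamily
import Literature.NumberTheory.Irrationality.BrownZudilin2022.CubicalForm
import Literature.NumberTheory.Irrationality.BrownZudilin2022.BarnesRepresentation

/-!
# The (H1)-free KERNEL ROUTE — master lemma: kernel certificate ⇒ value relation (cell `pub-zeta5`, lineage gen-1, g20)

HONEST FRAMING: systematic search; no irrationality claim unless certified.  Structure of gen-1's period dictionary
(`WedgeDictionary.explicitPQ`, an open conjecture node) only; nothing about linear forms or ζ(5); nothing is evaluated.

OUR work (Summit side).  Inputs, all as HYPOTHESES (named Literature facts of Brown–Zudilin, arXiv:2210.03391):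
* (8) = cubical form and (10) = the 12-parameter integral: `cellularIntegral_eq_cubicalIntegral`, `cubicalIntegral_eq_Jintegral`
  (`CubicalForm.lean`), i.e. `I(a) = J(p(a); q(a))` for convergent `a`;
* (16) the Barnes double-integral representation `barnes_double` (`BarnesRepresentation.lean`): for `p, q ≥ 0` and `(c₁,c₂)`
  in the `Chamber`, `J(p;q) = K(p;q) · (4π²)⁻¹ ∫∫ barnesKernel p q (−c₁+iy₁) (−c₂+iy₂)`.
Given a target family point `(p₀;q₀) = (pOf a₀; qOf a₀)`, finitely many family points `(pᵢ;qᵢ)`, all convergent with `p,q ≥ 0`,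
integer contour shifts `nᵢ` with `(c₁+nᵢ₁, c₂+nᵢ₂)` in the chamber of point `i`, and a POINTWISE KERNEL IDENTITY on the reference
contour `Φ₀(ref(y) − m) = Σᵢ ρᵢ Φᵢ(ref(y) − nᵢ)` (per-certificate Γ-algebra; see `WedgeDictionaryKernelUniform.lean` for the uniform
corner certificates and the cell's staged data-form files for fixed levels), conclude the VALUE RELATION
`I(a₀) = Σᵢ (K₀ ρᵢ / Kᵢ) · I(aᵢ)`.  Proof: linearity of the Bochner integral + bookkeeping; every side condition is decidable
(`ChamberQ`), so an instance needs only its data, `decide`s and the kernel identity.  No hypergeometric input (H1), no invariance.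
-/

set_option maxHeartbeats 1600000
set_option linter.style.longLine false

namespace Summit.KontsevichZagierPeriods.Zeta5Search.WedgeDictionary.Kernel

open Literature.NumberTheory.Irrationality.BrownZudilin2022 MeasureTheory

/-- The prefactor `K(p;q)` is a quotient of products of factorials, hence positive. -/
theorem barnesPrefactor_pos (p : Fin 7 → ℤ) (q : Fin 5 → ℤ) : 0 < barnesPrefactor p q := by
  unfold barnesPrefactor
  positivity

/-- Decidable (rational) form of the chamber condition: contour abscissae `c₁, c₂ ∈ ℚ`. -/
def ChamberQ (p : Fin 7 → ℤ) (q : Fin 5 → ℤ) (c₁ c₂ : ℚ) : Prop :=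
  0 < c₁ ∧ c₁ < 1 + min (p 0 : ℚ) (min (p 1 : ℚ) (p 2 : ℚ)) ∧ 0 < c₂ ∧ c₂ < 1 + min (p 4 : ℚ) (min (p 5 : ℚ) (p 6 : ℚ)) ∧
    (1 : ℚ) + p 0 + p 6 - q 2 < c₁ + c₂ ∧ c₁ + c₂ < (p 3 : ℚ) + 2

/-- `ChamberQ` is decidable (rational linear inequalities). (docstring added by the filing lane, P2 g7) -/
instance (p : Fin 7 → ℤ) (q : Fin 5 → ℤ) (c₁ c₂ : ℚ) : Decidable (ChamberQ p q c₁ c₂) := by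
  unfold ChamberQ; infer_instance

/-- The rational chamber condition implies the real one. (docstring added by the filing lane, P2 g7) -/
theorem chamber_of_chamberQ {p : Fin 7 → ℤ} {q : Fin 5 → ℤ} {c₁ c₂ : ℚ} (h : ChamberQ p q c₁ c₂) :
    Chamber p q (c₁ : ℝ) (c₂ : ℝ) := by
  obtain ⟨h1, h2, h3, h4, h5, h6⟩ := h
  refine ⟨by exact_mod_cast h1, ?_, by exact_mod_cast h3, ?_, by exact_mod_cast h5, by exact_mod_cast h6⟩
  · have := h2; push_cast at this ⊢; exact_mod_cast this
  · have := h4; push_cast at this ⊢; exact_mod_cast this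

/-- **MASTER lemma (M1).**  A pointwise kernel certificate on a common reference contour `(c₁, c₂) ∈ ℚ²` yields the value
relation among cellular integrals, given F1 and F2.  Every side condition is DECIDABLE (`decide` per instance); the only
real hypothesis is the kernel identity `hker` (per-certificate Γ-algebra).  Index type `Fin k` for the right-hand points. -/
theorem corner_of_certificate {k : ℕ} (h8 : cellularIntegral_eq_cubicalIntegral) (h10 : cubicalIntegral_eq_Jintegral)
    (hF2 : barnes_double)
    (a₀ : Fin 8 → ℤ) (p₀ : Fin 7 → ℤ) (q₀ : Fin 5 → ℤ) (m₁ m₂ : ℤ)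
    (a : Fin k → Fin 8 → ℤ) (p : Fin k → Fin 7 → ℤ) (q : Fin k → Fin 5 → ℤ) (n₁ n₂ : Fin k → ℤ)
    (ρ : Fin k → ℚ) (c₁ c₂ : ℚ)
    (hconv₀ : Converges a₀) (hp₀ : pOf a₀ = p₀) (hq₀ : qOf a₀ = q₀) (hpos₀ : ∀ j, 0 ≤ p₀ j) (hqpos₀ : ∀ j, 0 ≤ q₀ j)
    (hch₀ : ChamberQ p₀ q₀ (c₁ + m₁) (c₂ + m₂))
    (hconv : ∀ i, Converges (a i)) (hp : ∀ i, pOf (a i) = p i) (hq : ∀ i, qOf (a i) = q i)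
    (hpos : ∀ i j, 0 ≤ p i j) (hqpos : ∀ i j, 0 ≤ q i j)
    (hch : ∀ i, ChamberQ (p i) (q i) (c₁ + n₁ i) (c₂ + n₂ i))
    (hker : ∀ y : ℝ × ℝ,
      barnesKernel p₀ q₀ ((-((c₁ : ℝ) : ℂ) + (y.1 : ℂ) * Complex.I) - (m₁ : ℂ)) ((-((c₂ : ℝ) : ℂ) + (y.2 : ℂ) * Complex.I) - (m₂ : ℂ)) =
        ∑ i, ((ρ i : ℝ) : ℂ) * barnesKernel (p i) (q i) ((-((c₁ : ℝ) : ℂ) + (y.1 : ℂ) * Complex.I) - (n₁ i : ℂ))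
          ((-((c₂ : ℝ) : ℂ) + (y.2 : ℂ) * Complex.I) - (n₂ i : ℂ))) :
    cellularIntegral a₀ = ∑ i, (barnesPrefactor p₀ q₀ * (ρ i : ℝ) / barnesPrefactor (p i) (q i)) * cellularIntegral (a i) := by
  -- F2 at the target and at every right-hand point, contours written as reference point minus shift
  have hpt : ∀ (pp : Fin 7 → ℤ) (qq : Fin 5 → ℤ) (e₁ e₂ : ℤ) (y : ℝ × ℝ),
      barnesKernel pp qq (-((((c₁ + e₁ : ℚ) : ℝ)) : ℂ) + (y.1 : ℂ) * Complex.I) (-((((c₂ + e₂ : ℚ) : ℝ)) : ℂ) + (y.2 : ℂ) * Complex.I) =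
        barnesKernel pp qq ((-((c₁ : ℝ) : ℂ) + (y.1 : ℂ) * Complex.I) - (e₁ : ℂ)) ((-((c₂ : ℝ) : ℂ) + (y.2 : ℂ) * Complex.I) - (e₂ : ℂ)) := by
    intro pp qq e₁ e₂ y
    congr 1 <;> push_cast <;> ring
  have hT := hF2 p₀ q₀ ((c₁ + m₁ : ℚ) : ℝ) ((c₂ + m₂ : ℚ) : ℝ) hpos₀ hqpos₀ (chamber_of_chamberQ hch₀)
  simp_rw [hpt] at hT
  obtain ⟨hI₀, hJ₀⟩ := hT
  have hR : ∀ i, MeasureTheory.Integrable (fun y : ℝ × ℝ => barnesKernel (p i) (q i)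
        ((-((c₁ : ℝ) : ℂ) + (y.1 : ℂ) * Complex.I) - (n₁ i : ℂ)) ((-((c₂ : ℝ) : ℂ) + (y.2 : ℂ) * Complex.I) - (n₂ i : ℂ))) ∧
      (Jintegral (p i) (q i) : ℂ) = (barnesPrefactor (p i) (q i) : ℂ) * ((4 : ℂ) * (Real.pi : ℂ) ^ 2)⁻¹ *
        ∫ y : ℝ × ℝ, barnesKernel (p i) (q i) ((-((c₁ : ℝ) : ℂ) + (y.1 : ℂ) * Complex.I) - (n₁ i : ℂ))
          ((-((c₂ : ℝ) : ℂ) + (y.2 : ℂ) * Complex.I) - (n₂ i : ℂ)) := by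
    intro i
    have h := hF2 (p i) (q i) ((c₁ + n₁ i : ℚ) : ℝ) ((c₂ + n₂ i : ℚ) : ℝ) (hpos i) (hqpos i) (chamber_of_chamberQ (hch i))
    simp_rw [hpt] at h
    exact h
  -- F1 = (8) ∘ (10) at every point
  have hcell₀ : cellularIntegral a₀ = Jintegral p₀ q₀ := by
    rw [h8 a₀ hconv₀, h10 a₀ hconv₀, hp₀, hq₀]
  have hcell : ∀ i, cellularIntegral (a i) = Jintegral (p i) (q i) := by
    intro i
    rw [h8 (a i) (hconv i), h10 (a i) (hconv i), hp i, hq i]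
  have hK : ∀ i, (barnesPrefactor (p i) (q i) : ℂ) ≠ 0 := fun i => by
    exact_mod_cast (barnesPrefactor_pos (p i) (q i)).ne'
  -- linearity of the integral
  have hlin : (∫ y : ℝ × ℝ, barnesKernel p₀ q₀ ((-((c₁ : ℝ) : ℂ) + (y.1 : ℂ) * Complex.I) - (m₁ : ℂ))
        ((-((c₂ : ℝ) : ℂ) + (y.2 : ℂ) * Complex.I) - (m₂ : ℂ))) =
      ∑ i, ((ρ i : ℝ) : ℂ) * ∫ y : ℝ × ℝ, barnesKernel (p i) (q i) ((-((c₁ : ℝ) : ℂ) + (y.1 : ℂ) * Complex.I) - (n₁ i : ℂ))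
          ((-((c₂ : ℝ) : ℂ) + (y.2 : ℂ) * Complex.I) - (n₂ i : ℂ)) := by
    simp_rw [hker]
    rw [MeasureTheory.integral_finsetSum _ (fun i _ => (hR i).1.const_mul (((ρ i : ℝ) : ℂ)))]
    refine Finset.sum_congr rfl fun i _ => ?_
    exact MeasureTheory.integral_const_mul _ _
  -- assemble in ℂ, then cast back
  have hC : (cellularIntegral a₀ : ℂ) =
      ∑ i, ((barnesPrefactor p₀ q₀ * (ρ i : ℝ) / barnesPrefactor (p i) (q i) : ℝ) : ℂ) * (cellularIntegral (a i) : ℂ) := by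
    rw [hcell₀, hJ₀, hlin, Finset.mul_sum]
    refine Finset.sum_congr rfl fun i _ => ?_
    rw [hcell i, (hR i).2]
    set X := ∫ y : ℝ × ℝ, barnesKernel (p i) (q i) ((-((c₁ : ℝ) : ℂ) + (y.1 : ℂ) * Complex.I) - (n₁ i : ℂ))
          ((-((c₂ : ℝ) : ℂ) + (y.2 : ℂ) * Complex.I) - (n₂ i : ℂ)) with hX
    push_cast
    field_simp [hK i]
  exact_mod_cast hC

end Summit.KontsevichZagierPeriods.Zeta5Search.WedgeDictionary.Kernel
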